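import Mathlib.Analysis.InnerProductSpace.Basic
import Literature.MathematicalPhysics.QuantumFieldTheory.Balaban1983to89.B4Eq19LatticeDirichletReplacement
import HarnessLib

/-!
# Line «poincare_lipschitz» on crux `HistoryTailL` (stmt-QuantumFields-19936), route crux `BlockLipschitzL` (stmt-QuantumFields-23533), K2 organ of record LOC-REG-MIN —
# FLAT SHADOW «ENERGY → RANGE» (E→R) FOR LATTICE MINIMISERS INTO A SPHERE, FILE 1: THE COMPONENTWISE-HARMONIC EXTENSION OF NEAR-SPHERE DATA STAYS NEAR THE SPHERE,
# KERNEL-FREE — subharmonicity of `‖H − c‖²`, the discrete maximum principle for SUBSOLUTIONS on a box, the quadratic harmonic polynomial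
# `q(y) = Σ_i (y_i − x_i)² + d·(y_{i₀} − a)(b − y_{i₀})` (`−Δ_{ℤᵈ} q = 0` exactly), and the comparison `‖H x − c‖² ≤ A + B·d·((r+1)² − (x_{i₀} − z_{i₀})²)`

Cell `ym3-torus` (YM ladder rung R3 = continuum SU(2) Yang–Mills on the three-torus — a RUNG, NOT the Clay problem: not d = 4, not infinite volume, not a mass gap); width seat
`ym-ust-19936-w5` gen 12 (LEAD ym-ust-19936-w1 g8 2026-08-29T04:37:48Z: «the energy→range bridge on ℤ³ is the located XL gap, ★w5 memo (4)»; my LOCATE `E2R-ROAD-w5g12.md`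
(19936∕23533 evidence) §1, §3 brick F1).  THEOREMS ONLY (def-free), in the `ℤ^d` letters of lit ✓`B4Eq19LatticeOperators` (`Zd`, `box`, `unitVec`, `lop`) with values in ANY
real inner-product space `V` (`V = ℝ⁴ ⊃ S³ ≅ SU(2)` is the instance of record) and in px7 g5's SMALL-RANGE letters (componentwise harmonicity written as
`Σ_μ ((H y + H y) − H(y − e_μ) − H(y + e_μ)) = 0`); `--supports stmt-QuantumFields-19936`.  Nothing here proves LOC-REG-MIN, `hReg`, hG, a per-bond chart, E→R itself, a stub,
`BlockLipschitzL`, `HistoryTailL` or a summit statement; nothing twisted ∕ covariant is in this file.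

WHY (E→R road, step (v) of `E2R-ROAD-w5g12.md` §2): the Schoen–Uhlenbeck competitor on `Q' ⊂ ℤ³` is `π(H)`, `H` the componentwise-harmonic extension of near-sphere,
`ℓ`-Lipschitz boundary data `g`, `π(v) = v∕‖v‖`; its energy is `≤ (1 − η)⁻²·E(H)` once `‖H‖ ≥ 1 − η` INSIDE the box.  In the continuum that is a Poisson-kernel statement
(`1 − |H(x)|² = E_x|g(X_T) − H(x)|²`, second moment of harmonic measure `E_x|X_T − x|² = E_x T ≤ d·t·w`).  Here it is proved with NO kernel and NO walk:
* §1 `normSq_sub_sub_normSq_sub` (`‖a − c‖² − ‖b − c‖² = ‖a − b‖² + 2⟪b − c, a − b⟫`), ★ `lop_normSq_sub_eq` — the EXACT lattice identity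
  `−Δ‖H − c‖²(x) = −Σ_{y∼x}‖H y − H x‖² + 2⟪H x − c, (−ΔH)(x)⟫`, `lop_normSq_sub_nonpos_of_vecHarmonic` (`‖H − c‖²` is flat-subharmonic where `H` is componentwise harmonic);
* §2 ★ `le_of_subharmonic_of_le_on_layer` — THE DISCRETE MAXIMUM PRINCIPLE FOR SUBSOLUTIONS on a box: `−Δf ≤ 0` on `Q_r(z)`, `f ≤ M` on the layer `Q_{r+1}(z) ∖ Q_r(z)` ⟹
  `f ≤ M` on `Q_{r+1}(z)` (a maximum point inside forces its `+e_0`-neighbour to be a maximum point; walk to the face; px7 g5's ⧗`le_of_harmonic_of_le_on_layer` is the `= 0` case);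
* §3 `sum_sq_shift_add` ∕ `sum_sq_shift_sub` (`Σ_i ((y ± e_μ)_i − x_i)² = Σ_i (y_i − x_i)² ± 2(y_μ − x_μ) + 1`), ★ `lop_sqDist` (`−Δ Σ_i(y_i − x_i)² = −2d`),
  ★ `lop_faceProd` (`−Δ (y_{i₀} − a)(b − y_{i₀}) = 2`), ★★ `lop_quadHarmonic` (`−Δ q = 0` for `q = Σ_i(y_i − x_i)² + d·(y_{i₀} − a)(b − y_{i₀})`);
* §4 ★★★ `normSq_sub_le_of_vecHarmonic` — THE COMPARISON: `H` componentwise harmonic on `Q_r(z)`, `x ∈ Q_{r+1}(z)`, `B ≥ 0`, and `‖H y − c‖² ≤ A + B·Σ_i (y_i − x_i)²` on the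
  layer ⟹ `‖H x − c‖² ≤ A + B·d·((r+1)² − (x_{i₀} − z_{i₀})²)` for every direction `i₀` (comparison with the harmonic majorant `A + B·q`, `a = z_{i₀} − r − 1`, `b = z_{i₀} + r + 1`);
  `normSq_sub_le_of_vecHarmonic_depth` (`… ≤ A + B·d·2(r+1)·(r + 1 − |x_{i₀} − z_{i₀}|)` — linear in the DEPTH in direction `i₀`); ★★ `norm_ge_of_vecHarmonic` (`‖c‖ = 1` ⟹
  `‖H x‖ ≥ 1 − √(A + B·d·((r+1)² − (x_{i₀} − z_{i₀})²))`); `normSq_sub_le_of_vecHarmonic_of_lipschitz` (the `ℓ¹`-Lipschitz-data instance `A = 2ℓ²D²`, `B = 2dℓ²`).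
[folklore] (the continuum∕probabilistic statement: Lawler–Limic, *Random Walk: A Modern Introduction* §6.2 (`|S_n|² − n` martingale, exit times of boxes); the use:
[SchoenUhlenbeck1982] §4 extension lemma; [Giaquinta1984] Ch. VI §3 p.136 maximum principle for the comparison map; the lattice statements are this file's).
-/

set_option autoImplicit false

noncomputable section

open scoped BigOperators InnerProductSpace
open Finset

namespace Summit.QuantumFields.YangMills.Theorems.PoincareLipschitzSphereMapHarmonicExtensionNearSphere

open Literature.MathematicalPhysics.QuantumFieldTheory.Balaban1983to89
open B4Eq19LatticeOperators
open B4Eq19LatticeDirichletReplacement (lop_add)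

variable {d : ℕ} {V : Type*} [NormedAddCommGroup V] [InnerProductSpace ℝ V]

/-! ## §1 `‖H − c‖²` is flat-subharmonic where `H` is componentwise harmonic -/

/-- `‖a − c‖² − ‖b − c‖² = ‖a − b‖² + 2⟪b − c, a − b⟫`. [folklore] -/
theorem normSq_sub_sub_normSq_sub (a b c : V) : ‖a - c‖ ^ 2 - ‖b - c‖ ^ 2 = ‖a - b‖ ^ 2 + 2 * ⟪b - c, a - b⟫_ℝ := by
  have e : a - c = (a - b) + (b - c) := by abel
  rw [e, @norm_add_sq_real, real_inner_comm]
  ring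

/-- ★ **THE EXACT LATTICE IDENTITY** `(−Δ‖H − c‖²)(x) = −Σ_μ (‖H(x+e_μ) − H x‖² + ‖H(x−e_μ) − H x‖²) − 2⟪H x − c, Σ_μ ((H(x+e_μ) − H x) + (H(x−e_μ) − H x))⟫`
(the lattice `Δ|H − c|² = 2|∇H|² + 2⟨H − c, ΔH⟩`, with no remainder). [folklore] -/
theorem lop_normSq_sub_eq (H : Zd d → V) (c : V) (x : Zd d) :
    lop 0 (fun y => ‖H y - c‖ ^ 2) x =
      -(∑ μ, (‖H (x + unitVec μ) - H x‖ ^ 2 + ‖H (x - unitVec μ) - H x‖ ^ 2)) -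
        2 * ⟪H x - c, ∑ μ, ((H (x + unitVec μ) - H x) + (H (x - unitVec μ) - H x))⟫_ℝ := by
  rw [lop_apply, zero_mul, add_zero, inner_sum, Finset.mul_sum, ← Finset.sum_neg_distrib, ← Finset.sum_sub_distrib]
  refine Finset.sum_congr rfl fun μ _ => ?_
  have h1 := normSq_sub_sub_normSq_sub (H (x + unitVec μ)) (H x) c
  have h2 := normSq_sub_sub_normSq_sub (H (x - unitVec μ)) (H x) c
  rw [inner_add_right]
  linarith

/-- **`‖H − c‖²` IS FLAT-SUBHARMONIC WHERE `H` IS COMPONENTWISE HARMONIC**: if `Σ_μ ((H x + H x) − H(x−e_μ) − H(x+e_μ)) = 0` (the vector Laplacian vanishes at `x`, px7 g5's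
letters) then `(−Δ‖H − c‖²)(x) = −Σ_μ (‖H(x+e_μ) − H x‖² + ‖H(x−e_μ) − H x‖²) ≤ 0`. [folklore] [cite: Giaquinta1984, Ch. VI §3 p.136] -/
theorem lop_normSq_sub_eq_of_vecHarmonic (H : Zd d → V) (c : V) (x : Zd d)
    (hH : ∑ μ, ((H x + H x) - H (x - unitVec μ) - H (x + unitVec μ)) = 0) :
    lop 0 (fun y => ‖H y - c‖ ^ 2) x = -(∑ μ, (‖H (x + unitVec μ) - H x‖ ^ 2 + ‖H (x - unitVec μ) - H x‖ ^ 2)) := by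
  have hs : ∑ μ, ((H (x + unitVec μ) - H x) + (H (x - unitVec μ) - H x)) = 0 := by
    have e : ∑ μ, ((H (x + unitVec μ) - H x) + (H (x - unitVec μ) - H x)) = -∑ μ, ((H x + H x) - H (x - unitVec μ) - H (x + unitVec μ)) := by
      rw [← Finset.sum_neg_distrib]; exact Finset.sum_congr rfl fun μ _ => by abel
    rw [e, hH, neg_zero]
  rw [lop_normSq_sub_eq, hs, inner_zero_right, mul_zero, sub_zero]

/-- Under componentwise harmonicity at `x`, `(−Δ‖H − c‖²)(x) ≤ 0`. [folklore] [cite: Giaquinta1984, Ch. VI §3 p.136] -/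
theorem lop_normSq_sub_nonpos_of_vecHarmonic (H : Zd d → V) (c : V) (x : Zd d)
    (hH : ∑ μ, ((H x + H x) - H (x - unitVec μ) - H (x + unitVec μ)) = 0) :
    lop 0 (fun y => ‖H y - c‖ ^ 2) x ≤ 0 := by
  rw [lop_normSq_sub_eq_of_vecHarmonic H c x hH, neg_nonpos]
  exact Finset.sum_nonneg fun μ _ => by positivity

/-! ## §2 The discrete maximum principle for subsolutions on a box -/

/-- At a maximum point of a subsolution the forward neighbour in direction `e_0` is again a maximum point: `(−Δf)(y) ≤ 0`, `f ≤ M'` at the `2d` neighbours of `y`,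
`f y = M'` ⟹ `f(y + e_0) = M'` (`d ≥ 1`). [folklore] -/
theorem eq_of_subharmonic_max (hd : 0 < d) (f : Zd d → ℝ) {y : Zd d} {M' : ℝ} (hf : lop 0 f y ≤ 0)
    (hle : ∀ μ : Fin d, f (y + unitVec μ) ≤ M' ∧ f (y - unitVec μ) ≤ M') (hy : f y = M') : f (y + unitVec ⟨0, hd⟩) = M' := by
  have hsum : ∑ μ : Fin d, ((M' - f (y + unitVec μ)) + (M' - f (y - unitVec μ))) ≤ 0 := by
    rw [lop_apply, zero_mul, add_zero] at hf
    have e : ∑ μ : Fin d, ((M' - f (y + unitVec μ)) + (M' - f (y - unitVec μ))) = ∑ μ : Fin d, (2 * f y - f (y + unitVec μ) - f (y - unitVec μ)) :=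
      Finset.sum_congr rfl fun μ _ => by rw [hy]; ring
    rw [e]; exact hf
  have hnn : ∀ μ ∈ (Finset.univ : Finset (Fin d)), 0 ≤ (M' - f (y + unitVec μ)) + (M' - f (y - unitVec μ)) :=
    fun μ _ => add_nonneg (by linarith [(hle μ).1]) (by linarith [(hle μ).2])
  have h0 : (M' - f (y + unitVec ⟨0, hd⟩)) + (M' - f (y - unitVec ⟨0, hd⟩)) = 0 := by
    have hs0 : ∑ μ : Fin d, ((M' - f (y + unitVec μ)) + (M' - f (y - unitVec μ))) = 0 := le_antisymm hsum (Finset.sum_nonneg hnn)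
    exact (Finset.sum_eq_zero_iff_of_nonneg hnn).1 hs0 ⟨0, hd⟩ (Finset.mem_univ _)
  linarith [(hle ⟨0, hd⟩).1, (hle ⟨0, hd⟩).2]

/-- ★ **THE DISCRETE MAXIMUM PRINCIPLE FOR SUBSOLUTIONS ON A BOX**: `d ≥ 1`, `r ≥ 0`; if `(−Δf) ≤ 0` on `Q_r(z)` and `f ≤ M` on the layer `Q_{r+1}(z) ∖ Q_r(z)`, then
`f ≤ M` on `Q_{r+1}(z)` (take a maximum point on the finite set `Q_{r+1}(z)`; if it lies in `Q_r(z)`, walk along `e_0` to the face keeping the maximum). [folklore]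
[cite: Giaquinta1984, Ch. VI §3 p.136 (maximum principle for the comparison map)] -/
theorem le_of_subharmonic_of_le_on_layer (hd : 0 < d) (f : Zd d → ℝ) (z : Zd d) {r : ℤ} (hr : 0 ≤ r) {M : ℝ}
    (hf : ∀ y ∈ box z r, lop 0 f y ≤ 0) (hM : ∀ x ∈ box z (r + 1), x ∉ box z r → f x ≤ M) :
    ∀ y ∈ box z (r + 1), f y ≤ M := by
  classical
  have hne : (box z (r + 1)).Nonempty := ⟨z, self_mem_box z (by linarith)⟩
  obtain ⟨ys, hys, hmax⟩ := Finset.exists_max_image (box z (r + 1)) f hne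
  set M' := f ys with hM'
  suffices hkey : M' ≤ M by
    intro y hy; exact (hmax y hy).trans hkey
  by_contra hlt
  push Not at hlt
  -- walking up along `e_0` from a maximum point: impossible
  have walk : ∀ n : ℕ, ∀ y ∈ box z (r + 1), f y = M' → z ⟨0, hd⟩ + (r + 1) - y ⟨0, hd⟩ ≤ (n : ℤ) → False := by
    intro n
    induction n with
    | zero =>
      intro y hy hfy hn
      have hyr : y ∉ box z r := by
        intro hmem
        have h := (mem_box.1 hmem) ⟨0, hd⟩
        have h' := (abs_le.1 h).2
        push_cast at hn
        linarith
      have := hM y hy hyr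
      linarith
    | succ n ih =>
      intro y hy hfy hn
      by_cases hyr : y ∈ box z r
      · -- interior maximum point: the forward neighbour is a maximum point, one step closer to the face
        have hle : ∀ μ : Fin d, f (y + unitVec μ) ≤ M' ∧ f (y - unitVec μ) ≤ M' :=
          fun μ => ⟨hmax _ (add_unitVec_mem_box hyr μ), hmax _ (sub_unitVec_mem_box hyr μ)⟩
        have hnext := eq_of_subharmonic_max hd f (hf y hyr) hle hfy
        refine ih (y + unitVec ⟨0, hd⟩) (add_unitVec_mem_box hyr _) hnext ?_
        simp only [Pi.add_apply, unitVec_apply_self]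
        push_cast at hn ⊢
        linarith
      · have := hM y hy hyr
        linarith
  -- the maximum point `ys` starts the walk
  have hbound : z ⟨0, hd⟩ + (r + 1) - ys ⟨0, hd⟩ ≤ ((2 * r + 2).toNat : ℤ) := by
    have h := (mem_box.1 hys) ⟨0, hd⟩
    have h' := (abs_le.1 h).1
    rw [Int.toNat_of_nonneg (by linarith)]
    linarith
  exact walk _ ys hys rfl hbound

/-- **THE MAXIMUM PRINCIPLE, VECTOR FORM**: if `H` is componentwise harmonic on `Q_r(z)` (`d ≥ 1`, `r ≥ 0`) and `F ≥ ‖H − c‖²` on the layer for a function `F` with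
`−ΔF = 0` on `Q_r(z)`, then `‖H − c‖² ≤ F` on `Q_{r+1}(z)`. [folklore] [cite: Giaquinta1984, Ch. VI §3 p.136] -/
theorem normSq_sub_le_of_harmonic_majorant (hd : 0 < d) (H : Zd d → V) (c : V) (F : Zd d → ℝ) (z : Zd d) {r : ℤ} (hr : 0 ≤ r)
    (hH : ∀ y ∈ box z r, ∑ μ, ((H y + H y) - H (y - unitVec μ) - H (y + unitVec μ)) = 0)
    (hF : ∀ y ∈ box z r, lop 0 F y = 0) (hlayer : ∀ y ∈ box z (r + 1), y ∉ box z r → ‖H y - c‖ ^ 2 ≤ F y) :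
    ∀ y ∈ box z (r + 1), ‖H y - c‖ ^ 2 ≤ F y := by
  have hsub : ∀ y ∈ box z r, lop 0 (fun x => ‖H x - c‖ ^ 2 - F x) y ≤ 0 := by
    intro y hy
    rw [lop_sub, hF y hy, sub_zero]
    exact lop_normSq_sub_nonpos_of_vecHarmonic H c y (hH y hy)
  have h := le_of_subharmonic_of_le_on_layer hd (fun x => ‖H x - c‖ ^ 2 - F x) z hr (M := 0) hsub
    (fun y hy hyr => by have := hlayer y hy hyr; linarith)
  intro y hy
  have := h y hy
  linarith

/-! ## §3 The quadratic harmonic polynomial `q(y) = Σ_i (y_i − x_i)² + d·(y_{i₀} − a)(b − y_{i₀})` -/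

/-- Shifting by `+e_μ`: `Σ_i ((y + e_μ)_i − x_i)² = Σ_i (y_i − x_i)² + 2(y_μ − x_μ) + 1`. [folklore] -/
theorem sum_sq_shift_add (y x : Zd d) (μ : Fin d) :
    ∑ i, (((y + unitVec μ) i - x i : ℤ) : ℝ) ^ 2 = ∑ i, ((y i - x i : ℤ) : ℝ) ^ 2 + 2 * ((y μ - x μ : ℤ) : ℝ) + 1 := by
  have e : ∑ i, (((y + unitVec μ) i - x i : ℤ) : ℝ) ^ 2 = ∑ i, (((y i - x i : ℤ) : ℝ) ^ 2 + if i = μ then 2 * ((y μ - x μ : ℤ) : ℝ) + 1 else 0) := by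
    refine Finset.sum_congr rfl fun i _ => ?_
    by_cases hi : i = μ
    · subst hi; simp only [Pi.add_apply, unitVec_apply_self, if_true]; push_cast; ring
    · simp only [Pi.add_apply, unitVec_apply_ne hi, add_zero, hi, if_false]
  rw [e, Finset.sum_add_distrib, Finset.sum_ite_eq' Finset.univ μ, if_pos (Finset.mem_univ _)]
  ring

/-- Shifting by `−e_μ`: `Σ_i ((y − e_μ)_i − x_i)² = Σ_i (y_i − x_i)² − 2(y_μ − x_μ) + 1`. [folklore] -/
theorem sum_sq_shift_sub (y x : Zd d) (μ : Fin d) :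
    ∑ i, (((y - unitVec μ) i - x i : ℤ) : ℝ) ^ 2 = ∑ i, ((y i - x i : ℤ) : ℝ) ^ 2 - 2 * ((y μ - x μ : ℤ) : ℝ) + 1 := by
  have e : ∑ i, (((y - unitVec μ) i - x i : ℤ) : ℝ) ^ 2 = ∑ i, (((y i - x i : ℤ) : ℝ) ^ 2 + if i = μ then -2 * ((y μ - x μ : ℤ) : ℝ) + 1 else 0) := by
    refine Finset.sum_congr rfl fun i _ => ?_
    by_cases hi : i = μ
    · subst hi; simp only [Pi.sub_apply, unitVec_apply_self, if_true]; push_cast; ring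
    · simp only [Pi.sub_apply, unitVec_apply_ne hi, sub_zero, hi, if_false, add_zero]
  rw [e, Finset.sum_add_distrib, Finset.sum_ite_eq' Finset.univ μ, if_pos (Finset.mem_univ _)]
  ring

/-- ★ **`−Δ Σ_i (y_i − x_i)² = −2d`** on `ℤ^d` (every direction contributes `2q(y) − q(y+e_μ) − q(y−e_μ) = −2`). [folklore] -/
theorem lop_sqDist (x y : Zd d) : lop 0 (fun w => ∑ i, ((w i - x i : ℤ) : ℝ) ^ 2) y = -2 * d := by
  rw [lop_apply, zero_mul, add_zero]
  have e : ∀ μ : Fin d, 2 * (∑ i, ((y i - x i : ℤ) : ℝ) ^ 2) - (∑ i, (((y + unitVec μ) i - x i : ℤ) : ℝ) ^ 2) -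
      (∑ i, (((y - unitVec μ) i - x i : ℤ) : ℝ) ^ 2) = -2 := by
    intro μ; rw [sum_sq_shift_add, sum_sq_shift_sub]; ring
  simp only [e, Finset.sum_const, Finset.card_univ, Fintype.card_fin]
  ring

/-- ★ **`−Δ [(y_{i₀} − a)(b − y_{i₀})] = 2`** on `ℤ^d` (only the direction `i₀` contributes). [folklore] -/
theorem lop_faceProd (i₀ : Fin d) (a b : ℤ) (y : Zd d) :
    lop 0 (fun w => ((w i₀ - a : ℤ) : ℝ) * ((b - w i₀ : ℤ) : ℝ)) y = 2 := by
  rw [lop_apply, zero_mul, add_zero]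
  rw [Finset.sum_eq_single i₀]
  · simp only [Pi.add_apply, Pi.sub_apply, unitVec_apply_self]; push_cast; ring
  · intro μ _ hμ
    have hne : i₀ ≠ μ := fun h => hμ h.symm
    simp only [Pi.add_apply, Pi.sub_apply, unitVec_apply_ne hne, add_zero, sub_zero]; ring
  · intro h; exact absurd (Finset.mem_univ _) h

/-- ★★ **THE QUADRATIC HARMONIC POLYNOMIAL**: `q(y) = Σ_i (y_i − x_i)² + d·(y_{i₀} − a)(b − y_{i₀})` satisfies `−Δ_{ℤᵈ} q = 0` EXACTLY, at every site. [folklore]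
(the lattice form of «`|X_n − x|² − n` is a martingale and `(X_n^{i₀} − a)(b − X_n^{i₀}) + n∕d` is a martingale for the simple random walk») -/
theorem lop_quadHarmonic (x : Zd d) (i₀ : Fin d) (a b : ℤ) (y : Zd d) :
    lop 0 (fun w => (∑ i, ((w i - x i : ℤ) : ℝ) ^ 2) + (d : ℝ) * (((w i₀ - a : ℤ) : ℝ) * ((b - w i₀ : ℤ) : ℝ))) y = 0 := by
  rw [lop_add, lop_sqDist, lop_const_mul, lop_faceProd]
  ring

/-! ## §4 The comparison: the componentwise-harmonic extension of near-sphere data stays near the sphere -/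

/-- ★★★ **THE KERNEL-FREE COMPARISON.**  `d ≥ 1`, `r ≥ 0`; `H : ℤ^d → V` componentwise harmonic on `Q_r(z)`; `x ∈ Q_{r+1}(z)`; `c ∈ V`, `A ∈ ℝ`, `B ≥ 0` with
`‖H y − c‖² ≤ A + B·Σ_i (y_i − x_i)²` on the layer `Q_{r+1}(z) ∖ Q_r(z)`.  THEN, for every direction `i₀`,
`‖H x − c‖² ≤ A + B·d·((r+1)² − (x_{i₀} − z_{i₀})²)`.
PROOF: `q(y) = Σ_i (y_i − x_i)² + d·(y_{i₀} − a)(b − y_{i₀})` with `a = z_{i₀} − r − 1`, `b = z_{i₀} + r + 1` is harmonic (`lop_quadHarmonic`) and `≥ Σ_i (y_i − x_i)²` on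
`Q_{r+1}(z)`; the maximum principle `normSq_sub_le_of_harmonic_majorant` with `F = A + B·q`; `q(x) = d·((r+1)² − (x_{i₀} − z_{i₀})²)`.  This is the lattice
«`1 − |H(x)|² ≤ Lip² · E_x|X_T − x|² = Lip² · E_x T ≤ Lip²·d·t·w`» with no harmonic measure and no walk. [folklore]
[cite: Giaquinta1984, Ch. VI §3 p.136 (comparison map via the maximum principle)] -/
theorem normSq_sub_le_of_vecHarmonic (hd : 0 < d) (H : Zd d → V) (c : V) (z x : Zd d) {r : ℤ} (hr : 0 ≤ r) (hx : x ∈ box z (r + 1))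
    (i₀ : Fin d) {A B : ℝ} (hB : 0 ≤ B)
    (hH : ∀ y ∈ box z r, ∑ μ, ((H y + H y) - H (y - unitVec μ) - H (y + unitVec μ)) = 0)
    (hlayer : ∀ y ∈ box z (r + 1), y ∉ box z r → ‖H y - c‖ ^ 2 ≤ A + B * ∑ i, ((y i - x i : ℤ) : ℝ) ^ 2) :
    ‖H x - c‖ ^ 2 ≤ A + B * d * (((r : ℝ) + 1) ^ 2 - ((x i₀ - z i₀ : ℤ) : ℝ) ^ 2) := by
  set a : ℤ := z i₀ - (r + 1) with ha
  set b : ℤ := z i₀ + (r + 1) with hb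
  -- the harmonic majorant `F = A + B q`
  set F : Zd d → ℝ := fun w => A + B * ((∑ i, ((w i - x i : ℤ) : ℝ) ^ 2) + (d : ℝ) * (((w i₀ - a : ℤ) : ℝ) * ((b - w i₀ : ℤ) : ℝ))) with hF
  have hFh : ∀ y ∈ box z r, lop 0 F y = 0 := by
    intro y _
    have e : F = fun w => A + B * ((∑ i, ((w i - x i : ℤ) : ℝ) ^ 2) + (d : ℝ) * (((w i₀ - a : ℤ) : ℝ) * ((b - w i₀ : ℤ) : ℝ))) := rfl
    rw [e, lop_add, lop_const_mul, lop_quadHarmonic, mul_zero, add_zero]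
    simp only [lop_apply, zero_mul, add_zero, Finset.sum_const, Finset.card_univ, Fintype.card_fin, nsmul_eq_mul]
    ring
  -- on the whole closed box the face product is non-negative
  have hprod : ∀ y ∈ box z (r + 1), 0 ≤ ((y i₀ - a : ℤ) : ℝ) * ((b - y i₀ : ℤ) : ℝ) := by
    intro y hy
    have h := (mem_box.1 hy) i₀
    have h1 := (abs_le.1 h).1
    have h2 := (abs_le.1 h).2
    have ha' : (0 : ℝ) ≤ ((y i₀ - a : ℤ) : ℝ) := by exact_mod_cast (by rw [ha]; linarith)
    have hb' : (0 : ℝ) ≤ ((b - y i₀ : ℤ) : ℝ) := by exact_mod_cast (by rw [hb]; linarith)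
    exact mul_nonneg ha' hb'
  have hlayer' : ∀ y ∈ box z (r + 1), y ∉ box z r → ‖H y - c‖ ^ 2 ≤ F y := by
    intro y hy hyr
    have h1 := hlayer y hy hyr
    have h2 := hprod y hy
    have : A + B * ∑ i, ((y i - x i : ℤ) : ℝ) ^ 2 ≤ F y := by
      simp only [hF]
      nlinarith [mul_nonneg hB (mul_nonneg (Nat.cast_nonneg d) h2)]
    exact h1.trans this
  have hmain := normSq_sub_le_of_harmonic_majorant hd H c F z hr hH hFh hlayer' x hx
  -- evaluate the majorant at the centre `x`
  have hFx : F x = A + B * d * (((r : ℝ) + 1) ^ 2 - ((x i₀ - z i₀ : ℤ) : ℝ) ^ 2) := by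
    simp only [hF, sub_self, Int.cast_zero]
    rw [zero_pow two_ne_zero, Finset.sum_const_zero, zero_add, ha, hb]
    push_cast
    ring
  rw [hFx] at hmain
  exact hmain

/-- **DEPTH FORM**: under the hypotheses of `normSq_sub_le_of_vecHarmonic`, `‖H x − c‖² ≤ A + B·d·(2(r+1))·(r + 1 − |x_{i₀} − z_{i₀}|)` — linear in the depth
`t = r + 1 − |x_{i₀} − z_{i₀}|` of `x` below the two faces normal to `e_{i₀}` (`(r+1)² − s² = (r+1−|s|)(r+1+|s|) ≤ (r+1−|s|)·2(r+1)`). [folklore] -/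
theorem normSq_sub_le_of_vecHarmonic_depth (hd : 0 < d) (H : Zd d → V) (c : V) (z x : Zd d) {r : ℤ} (hr : 0 ≤ r) (hx : x ∈ box z (r + 1))
    (i₀ : Fin d) {A B : ℝ} (hB : 0 ≤ B)
    (hH : ∀ y ∈ box z r, ∑ μ, ((H y + H y) - H (y - unitVec μ) - H (y + unitVec μ)) = 0)
    (hlayer : ∀ y ∈ box z (r + 1), y ∉ box z r → ‖H y - c‖ ^ 2 ≤ A + B * ∑ i, ((y i - x i : ℤ) : ℝ) ^ 2) :
    ‖H x - c‖ ^ 2 ≤ A + B * d * (2 * ((r : ℝ) + 1)) * (((r : ℝ) + 1) - |((x i₀ - z i₀ : ℤ) : ℝ)|) := by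
  have h := normSq_sub_le_of_vecHarmonic hd H c z x hr hx i₀ hB hH hlayer
  have hs : |((x i₀ - z i₀ : ℤ) : ℝ)| ≤ (r : ℝ) + 1 := by
    have := (mem_box.1 hx) i₀
    exact_mod_cast this
  have h0 : 0 ≤ |((x i₀ - z i₀ : ℤ) : ℝ)| := abs_nonneg _
  have hsq : ((x i₀ - z i₀ : ℤ) : ℝ) ^ 2 = |((x i₀ - z i₀ : ℤ) : ℝ)| ^ 2 := (sq_abs _).symm
  have key : ((r : ℝ) + 1) ^ 2 - ((x i₀ - z i₀ : ℤ) : ℝ) ^ 2 ≤ (2 * ((r : ℝ) + 1)) * (((r : ℝ) + 1) - |((x i₀ - z i₀ : ℤ) : ℝ)|) := by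
    rw [hsq]; nlinarith
  have hBd : 0 ≤ B * d := mul_nonneg hB (Nat.cast_nonneg d)
  nlinarith

/-- ★★ **NEAR THE SPHERE**: under the hypotheses of `normSq_sub_le_of_vecHarmonic` with `‖c‖ = 1`,
`‖H x‖ ≥ 1 − √(A + B·d·((r+1)² − (x_{i₀} − z_{i₀})²))` — so the radial projection `H∕‖H‖` is defined and `(1 − √…)⁻¹`-Lipschitz along `H` wherever the root is `< 1`.
[folklore] [cite: SchoenUhlenbeck1982, §4 (extension lemma: the harmonic extension of near-`N` data stays near `N`)] -/
theorem norm_ge_of_vecHarmonic (hd : 0 < d) (H : Zd d → V) (c : V) (hc : ‖c‖ = 1) (z x : Zd d) {r : ℤ} (hr : 0 ≤ r) (hx : x ∈ box z (r + 1))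
    (i₀ : Fin d) {A B : ℝ} (hB : 0 ≤ B)
    (hH : ∀ y ∈ box z r, ∑ μ, ((H y + H y) - H (y - unitVec μ) - H (y + unitVec μ)) = 0)
    (hlayer : ∀ y ∈ box z (r + 1), y ∉ box z r → ‖H y - c‖ ^ 2 ≤ A + B * ∑ i, ((y i - x i : ℤ) : ℝ) ^ 2) :
    1 - Real.sqrt (A + B * d * (((r : ℝ) + 1) ^ 2 - ((x i₀ - z i₀ : ℤ) : ℝ) ^ 2)) ≤ ‖H x‖ := by
  have h := normSq_sub_le_of_vecHarmonic hd H c z x hr hx i₀ hB hH hlayer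
  have h1 : ‖H x - c‖ ≤ Real.sqrt (A + B * d * (((r : ℝ) + 1) ^ 2 - ((x i₀ - z i₀ : ℤ) : ℝ) ^ 2)) := by
    rw [← Real.sqrt_sq (norm_nonneg (H x - c))]
    exact Real.sqrt_le_sqrt h
  have h2 : ‖c‖ - ‖H x - c‖ ≤ ‖H x‖ := by
    have := norm_sub_norm_le c (c - H x)
    rw [sub_sub_cancel, norm_sub_rev] at this
    linarith
  rw [hc] at h2
  linarith

/-- `(Σ_i |t_i|)² ≤ d·Σ_i t_i²` on `Fin d` (Cauchy–Schwarz). [folklore] -/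
theorem sq_sum_abs_le (t : Fin d → ℝ) : (∑ i, |t i|) ^ 2 ≤ d * ∑ i, t i ^ 2 := by
  have hcs : (∑ i, |t i| * 1) ^ 2 ≤ (∑ i, |t i| ^ 2) * (∑ _i : Fin d, (1 : ℝ) ^ 2) :=
    Finset.sum_mul_sq_le_sq_mul_sq Finset.univ (fun i => |t i|) (fun _ => (1 : ℝ))
  have e1 : (∑ _i : Fin d, (1 : ℝ) ^ 2) = d := by simp
  have e2 : (∑ i, |t i| ^ 2) = ∑ i, t i ^ 2 := Finset.sum_congr rfl fun i _ => sq_abs _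
  have e3 : (∑ i, |t i| * 1) = ∑ i, |t i| := Finset.sum_congr rfl fun i _ => mul_one _
  rw [e1, e2, e3] at hcs
  linarith

/-- **THE LIPSCHITZ-DATA INSTANCE**: if on the layer `‖H y − c‖ ≤ ℓ·(D + Σ_i |y_i − x_i|)` (e.g. `c = g(y₀)` for `ℓ¹`-Lipschitz data `g` and `D = |x − y₀|₁`), `ℓ, D ≥ 0`,
then `‖H x − c‖² ≤ 2ℓ²D² + 2dℓ²·d·((r+1)² − (x_{i₀} − z_{i₀})²)` (`A = 2ℓ²D²`, `B = 2dℓ²` by `(u+v)² ≤ 2u² + 2v²` and Cauchy–Schwarz on `Fin d`). [folklore] -/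
theorem normSq_sub_le_of_vecHarmonic_of_lipschitz (hd : 0 < d) (H : Zd d → V) (c : V) (z x : Zd d) {r : ℤ} (hr : 0 ≤ r) (hx : x ∈ box z (r + 1))
    (i₀ : Fin d) {ℓ D : ℝ} (hℓ : 0 ≤ ℓ) (hD : 0 ≤ D)
    (hH : ∀ y ∈ box z r, ∑ μ, ((H y + H y) - H (y - unitVec μ) - H (y + unitVec μ)) = 0)
    (hlayer : ∀ y ∈ box z (r + 1), y ∉ box z r → ‖H y - c‖ ≤ ℓ * (D + ∑ i, |((y i - x i : ℤ) : ℝ)|)) :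
    ‖H x - c‖ ^ 2 ≤ 2 * ℓ ^ 2 * D ^ 2 + (2 * d * ℓ ^ 2) * d * (((r : ℝ) + 1) ^ 2 - ((x i₀ - z i₀ : ℤ) : ℝ) ^ 2) := by
  have hB : 0 ≤ 2 * (d : ℝ) * ℓ ^ 2 := by positivity
  refine normSq_sub_le_of_vecHarmonic hd H c z x hr hx i₀ hB hH ?_
  intro y hy hyr
  have h1 := hlayer y hy hyr
  have hS0 : 0 ≤ ∑ i, |((y i - x i : ℤ) : ℝ)| := Finset.sum_nonneg fun i _ => abs_nonneg _
  have hrhs0 : 0 ≤ ℓ * (D + ∑ i, |((y i - x i : ℤ) : ℝ)|) := mul_nonneg hℓ (add_nonneg hD hS0)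
  have h2 : ‖H y - c‖ ^ 2 ≤ (ℓ * (D + ∑ i, |((y i - x i : ℤ) : ℝ)|)) ^ 2 := pow_le_pow_left₀ (norm_nonneg _) h1 2
  have hcs := sq_sum_abs_le (d := d) fun i => ((y i - x i : ℤ) : ℝ)
  have h3 : (ℓ * (D + ∑ i, |((y i - x i : ℤ) : ℝ)|)) ^ 2 ≤ 2 * ℓ ^ 2 * D ^ 2 + 2 * (d : ℝ) * ℓ ^ 2 * ∑ i, ((y i - x i : ℤ) : ℝ) ^ 2 := by
    have e : (ℓ * (D + ∑ i, |((y i - x i : ℤ) : ℝ)|)) ^ 2 = ℓ ^ 2 * (D + ∑ i, |((y i - x i : ℤ) : ℝ)|) ^ 2 := by ring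
    have h4 : (D + ∑ i, |((y i - x i : ℤ) : ℝ)|) ^ 2 ≤ 2 * D ^ 2 + 2 * (∑ i, |((y i - x i : ℤ) : ℝ)|) ^ 2 := by
      nlinarith [sq_nonneg (D - ∑ i, |((y i - x i : ℤ) : ℝ)|)]
    rw [e]
    nlinarith [mul_le_mul_of_nonneg_left h4 (sq_nonneg ℓ), mul_le_mul_of_nonneg_left hcs (by positivity : (0:ℝ) ≤ 2 * ℓ ^ 2)]
  linarith

end Summit.QuantumFields.YangMills.Theorems.PoincareLipschitzSphereMapHarmonicExtensionNearSphere
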